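/- LEAD seat `ym-line-cbag-p1` (prover-ym-line-cbag-p1-g23-0) leading LINE 7 `GlueballBandRecursion`, crux `OneGlueballBandDichotomy`
(stmt-QuantumFields-27554): the THERMAL DOOR — a Hilbert-space-free sufficient condition for the crux, for a polymer/cluster-expansion crew
(blueprint §2 "equivalent THERMAL target", evidence `blueprint-stub_bandLevels.md`).  Complements the registered SPECTRAL stub
`stub_bandLevels` (skeleton rev 2) and its bridge (Theorems/GlueballBandRecursionOneGlueballBandDichotomyBandLevels.lean). -/
import Summits.QuantumFields.YangMills.Theses.GlueballBandRecursion
import Summits.QuantumFields.YangMills.Theorems.GlueballBandRecursionOneGlueballBandLowerGaussianLatticeCount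
import Summits.QuantumFields.YangMills.Theorems.GlueballBandRecursionRateDictionary
import Summits.QuantumFields.YangMills.Theorems.GlueballBandRecursionRateToolkit

/-!
# Route `GlueballBandRecursion`, crux `OneGlueballBandDichotomy` (stmt-QuantumFields-27554): the thermal door —
# two-sided Bloch-form trace asymptotics imply the crux

For a crew that controls the cold-torus partition functions by the strong-coupling cluster expansion (the tree's Kotecký–Preiss
machinery, `PeriodicBoxFreeEnergyLimits` etc.) the natural output is not eigenvectors but TWO-SIDED BOUNDS ON THE THERMAL TRACE
`x_s(N) = traceExcess ρ β N s = Z_β(s × N³)/λ₊^s − 1` by an explicit finite family of Bloch weights `w_j`, `j = (p, b) ∈ (Fin N)³ × Fin n`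
(`p` a torus momentum, `b` a branch/species label; in the one-particle picture `w_{p,b} = e^{−E_b(2πp/N)}`, the decorated wandering tube =
random-walk expansion of the time-wrapping clusters).  THIS FILE proves that such bounds close the crux:

`oneGlueballBandLower_of_traceAsymptotics` / `oneGlueballBandDichotomy_of_traceAsymptotics`: if for every compact `G`, faithful `r` there are
`κ > 0`, `L₀` such that for `0 ≤ β ≤ strongCouplingRadius r.ρ` and `N ≥ L₀` there are `n` and weights `w : (Fin N)³ × Fin n → ℝ≥0` with
* (upper, ALL Euclidean times) `x_{m+2}(N) ≤ 2·Σ_j w_j^{m+2}` for every `m` — nothing sits above the family (the "upper gap"; this is what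
  identifies the rate: `q_N ≤ max_j w_j`, by `q_N = lim x_s^{1/s}`);
* (lower, times up to `N`) `½·Σ_j w_j^{m+2} ≤ x_{m+2}(N)` for `m + 2 ≤ N`;
* (band shape) a centre `p₀` with: for every `p` some branch `b` has `w_j·exp(−κ·momSq N (p − p₀)/N²) ≤ w_{(p,b)}` for ALL `j` (the top
  weight's momentum slice is Gaussian-flat — delivered by `Band.bandTop_flat_at_latticeArgmax` from a C² Bloch symbol,
  Theorems/GlueballBandRecursionOneGlueballBandDichotomyBandTopFlat.lean),
then `OneGlueballBandLower` (with `a = c(κ)/2`, `c` the Gaussian lattice count) and hence `OneGlueballBandDichotomy` hold BY NAME.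
Relative precision `2` is arbitrary but fixed; the `s → ∞` uniformity is required ONLY of the upper bound.

HONEST FRAMING.  This is a conditional door: the hypothesis is the finite-torus one-particle theorem in thermal clothes (XL, not in print
for the periodic torus); nothing about the crux, the rung `ColdDoublingRecursionStrongCoupling` or the Yang–Mills mass gap is proved here.
-/

set_option autoImplicit false

noncomputable section

open Filter Topology MeasureTheory Finset
open Literature.MathematicalPhysics.QuantumFieldTheory
open Literature.MathematicalPhysics.QuantumFieldTheory.Balaban1983to89.Missing (strongCouplingRadius)
open Summit.QuantumFields.YangMills.Theses.GlueballBandRecursion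

namespace Summit.QuantumFields.YangMills.Theorems.GlueballBandRecursion.Band

/-- `D^{1/(k+2)} → 1` as `k → ∞` for a positive constant `D`. -/
theorem tendsto_const_rpow_inv_add_two {D : ℝ} (hD : 0 < D) :
    Tendsto (fun k : ℕ => D ^ ((1 : ℝ) / ((k : ℝ) + 2))) atTop (𝓝 1) := by
  have h0 : Tendsto (fun k : ℕ => (1 : ℝ) / ((k : ℝ) + 2)) atTop (𝓝 0) := by
    have h := (tendsto_one_div_add_atTop_nhds_zero_nat (𝕜 := ℝ)).comp (tendsto_add_atTop_nat 1)
    refine h.congr fun k => ?_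
    simp only [Function.comp_apply]
    push_cast
    ring
  have h := (tendsto_const_nhds (x := D)).rpow h0 (Or.inl hD.ne')
  rwa [Real.rpow_zero] at h

/-- **The rate sits under the top weight**: if `x_{k+2}(N) ≤ D·W^{k+2}` for all `k` (`D > 0`, `W ≥ 0`, `β ≥ 0`), then `q_N ≤ W`
(`q_N = lim x_{k+2}^{1/(k+2)}` and `(D W^{k+2})^{1/(k+2)} = D^{1/(k+2)} W → W`). -/
theorem rate_le_of_traceExcess_le_mul_pow {G : Type} [Group G] [TopologicalSpace G] [IsTopologicalGroup G] [CompactSpace G]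
    [MeasurableSpace G] [BorelSpace G] (r : LatticeRep G) {β : ℝ} (hβ : 0 ≤ β) (N : ℕ) [NeZero N]
    {D W : ℝ} (hD : 0 < D) (hW : 0 ≤ W) (h : ∀ k : ℕ, traceExcess r.ρ β N (k + 2) ≤ D * W ^ (k + 2)) :
    (⨅ k : ℕ, traceExcess r.ρ β N (k + 2) ^ ((1 : ℝ) / ((k : ℝ) + 2))) ≤ W := by
  haveI : SecondCountableTopology G :=
    (r.continuous.isClosedEmbedding r.injective).isEmbedding.secondCountableTopology
  have hlim := tendsto_root_traceExcess r hβ N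
  have hlim' : Tendsto (fun k : ℕ => D ^ ((1 : ℝ) / ((k : ℝ) + 2)) * W) atTop (𝓝 W) := by
    have h := (tendsto_const_rpow_inv_add_two hD).mul_const W
    rwa [one_mul] at h
  refine le_of_tendsto_of_tendsto' hlim hlim' fun k => ?_
  have hx0 : 0 ≤ traceExcess r.ρ β N (k + 2) := Rate.traceExcess_nonneg r.continuous r.mem_unitary hβ N k
  have hexp : 0 ≤ (1 : ℝ) / ((k : ℝ) + 2) := by positivity
  have hexp' : (1 : ℝ) / ((k : ℝ) + 2) = ((k + 2 : ℕ) : ℝ)⁻¹ := by push_cast; rw [one_div]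
  calc traceExcess r.ρ β N (k + 2) ^ ((1 : ℝ) / ((k : ℝ) + 2))
      ≤ (D * W ^ (k + 2)) ^ ((1 : ℝ) / ((k : ℝ) + 2)) := Real.rpow_le_rpow hx0 (h k) hexp
    _ = D ^ ((1 : ℝ) / ((k : ℝ) + 2)) * (W ^ (k + 2)) ^ ((1 : ℝ) / ((k : ℝ) + 2)) :=
        Real.mul_rpow hD.le (pow_nonneg hW _)
    _ = D ^ ((1 : ℝ) / ((k : ℝ) + 2)) * W := by
        rw [hexp', Real.pow_rpow_inv_natCast hW (by omega)]

/-- **THE THERMAL DOOR (banked form): two-sided Bloch-form trace asymptotics ⇒ `OneGlueballBandLower`.**  See the module docstring for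
the reading of the three hypotheses (upper bound at all times, lower bound at times `≤ N`, Gaussian band shape of the top slice). -/
theorem oneGlueballBandLower_of_traceAsymptotics
    (hT : ∀ (G : Type) [Group G] [TopologicalSpace G] [IsTopologicalGroup G] [CompactSpace G],
      letI : MeasurableSpace G := borel G
      haveI : BorelSpace G := ⟨rfl⟩
      ∀ r : LatticeRep G, ∃ κ : ℝ, 0 < κ ∧ ∃ L₀ : ℕ, ∀ β : ℝ, 0 ≤ β → β ≤ strongCouplingRadius r.ρ →
        ∀ (N : ℕ) [NeZero N], L₀ ≤ N →
          ∃ (n : ℕ) (w : (Fin N × Fin N × Fin N) × Fin n → ℝ), (∀ j, 0 ≤ w j) ∧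
            (∀ m : ℕ, traceExcess r.ρ β N (m + 2) ≤ 2 * ∑ j, w j ^ (m + 2)) ∧
            (∀ m : ℕ, m + 2 ≤ N → (1 / 2 : ℝ) * ∑ j, w j ^ (m + 2) ≤ traceExcess r.ρ β N (m + 2)) ∧
            ∃ p₀ : Fin N × Fin N × Fin N, ∀ p : Fin N × Fin N × Fin N, ∃ b : Fin n, ∀ j,
              w j * Real.exp (-(κ * (momSq N (p - p₀) : ℝ) / (N : ℝ) ^ 2)) ≤ w (p, b)) :
    OneGlueballBandLower := by
  intro G _ _ _ _
  letI : MeasurableSpace G := borel G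
  haveI : BorelSpace G := ⟨rfl⟩
  intro r
  obtain ⟨κ, hκ, L₀, hL₀⟩ := hT G r
  obtain ⟨c, hc, N₀, hN₀⟩ := stub_gaussianLatticeCount κ hκ
  refine ⟨c / 2, by positivity, max L₀ N₀, fun β hβ0 hβ N _ m hm hN => ?_⟩
  haveI : SecondCountableTopology G :=
    (r.continuous.isClosedEmbedding r.injective).isEmbedding.secondCountableTopology
  have hL₀N : L₀ ≤ N := le_trans (le_max_left _ _) hN
  have hN₀N : N₀ ≤ N := le_trans (le_max_right _ _) hN
  have hmN : m + 2 ≤ N := by omega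
  obtain ⟨n, w, hw0, hup, hlow, p₀, hshape⟩ := hL₀ β hβ0 hβ N hL₀N
  set q : ℝ := ⨅ k : ℕ, traceExcess r.ρ β N (k + 2) ^ ((1 : ℝ) / ((k : ℝ) + 2)) with hqdef
  have hq0 : 0 ≤ q := Rate.rate_nonneg r.continuous r.mem_unitary hβ0 N
  have hx0 : 0 ≤ traceExcess r.ρ β N (m + 2) := Rate.traceExcess_nonneg r.continuous r.mem_unitary hβ0 N m
  have hcount := hN₀ N m hm hN₀N
  -- Case 1: no weights (empty index) — then `x ≡ 0`, `q = 0`, and the floor is `0 ≤ x`.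
  rcases isEmpty_or_nonempty ((Fin N × Fin N × Fin N) × Fin n) with hJ | hJ
  · haveI := hJ
    have hx00 : ∀ k, traceExcess r.ρ β N (k + 2) ≤ 1 * (0 : ℝ) ^ (k + 2) := fun k => by
      have h := hup k
      have hs : ∑ j : (Fin N × Fin N × Fin N) × Fin n, w j ^ (k + 2) = 0 :=
        Finset.sum_eq_zero fun j _ => (IsEmpty.false j).elim
      rw [hs, mul_zero] at h
      have h0 : (1 : ℝ) * (0 : ℝ) ^ (k + 2) = 0 := by rw [zero_pow (by omega), mul_zero]
      rw [h0]
      exact h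
    have hq00 : q ≤ 0 := rate_le_of_traceExcess_le_mul_pow r hβ0 N one_pos le_rfl hx00
    have hq : q = 0 := le_antisymm hq00 hq0
    calc c / 2 * Real.sqrt (N : ℝ) ^ 3 * q ^ (m + 2) = 0 := by rw [hq, zero_pow (by omega)]; ring
      _ ≤ traceExcess r.ρ β N (m + 2) := hx0
  -- Case 2: the top weight `W = w j*` carries the rate: `q ≤ W`.
  · haveI := hJ
    obtain ⟨jstar, -, hjstar⟩ := Finset.exists_max_image Finset.univ w Finset.univ_nonempty
    set W : ℝ := w jstar with hWdef
    have hW0 : 0 ≤ W := hw0 jstar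
    have hM : 0 < (Fintype.card ((Fin N × Fin N × Fin N) × Fin n) : ℝ) := by exact_mod_cast Fintype.card_pos
    have hD : 0 < 2 * (Fintype.card ((Fin N × Fin N × Fin N) × Fin n) : ℝ) := by positivity
    have hqW : q ≤ W := by
      refine rate_le_of_traceExcess_le_mul_pow r hβ0 N hD hW0 fun k => ?_
      calc traceExcess r.ρ β N (k + 2) ≤ 2 * ∑ j, w j ^ (k + 2) := hup k
        _ ≤ 2 * ∑ _j : (Fin N × Fin N × Fin N) × Fin n, W ^ (k + 2) := by
            refine mul_le_mul_of_nonneg_left (Finset.sum_le_sum fun j _ => ?_) (by norm_num)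
            exact pow_le_pow_left₀ (hw0 j) (hjstar j (Finset.mem_univ j)) _
        _ = 2 * (Fintype.card ((Fin N × Fin N × Fin N) × Fin n) : ℝ) * W ^ (k + 2) := by
            rw [Finset.sum_const, Finset.card_univ, nsmul_eq_mul]
            ring
    -- the band slice `p ↦ (p, b p)` of the family dominates `q^t · bandSum`
    choose b hb using hshape
    have hslice : q ^ (m + 2) * bandSum κ N (m + 2) ≤ ∑ p : Fin N × Fin N × Fin N, w (p, b p) ^ (m + 2) := by
      rw [bandSum, Finset.mul_sum]
      rw [← (Fintype.sum_equiv (Equiv.subRight p₀) (fun p => q ^ (m + 2) *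
        Real.exp (-(κ * ↑(m + 2) * (momSq N (p - p₀) : ℝ) / (N : ℝ) ^ 2))) _ fun p => rfl)]
      refine Finset.sum_le_sum fun p _ => ?_
      have h1 : q * Real.exp (-(κ * (momSq N (p - p₀) : ℝ) / (N : ℝ) ^ 2)) ≤ w (p, b p) :=
        le_trans (mul_le_mul_of_nonneg_right hqW (Real.exp_nonneg _)) (hb p jstar)
      have h0 : 0 ≤ q * Real.exp (-(κ * (momSq N (p - p₀) : ℝ) / (N : ℝ) ^ 2)) := mul_nonneg hq0 (Real.exp_nonneg _)
      have hexp : Real.exp (-(κ * (momSq N (p - p₀) : ℝ) / (N : ℝ) ^ 2)) ^ (m + 2) =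
          Real.exp (-(κ * ↑(m + 2) * (momSq N (p - p₀) : ℝ) / (N : ℝ) ^ 2)) := by
        rw [← Real.exp_nat_mul]
        congr 1
        ring
      have h2 := pow_le_pow_left₀ h0 h1 (m + 2)
      rwa [mul_pow, hexp] at h2
    -- the slice is a sub-family of non-negative terms
    have hsub : ∑ p : Fin N × Fin N × Fin N, w (p, b p) ^ (m + 2) ≤ ∑ j, w j ^ (m + 2) := by
      have hinj : Function.Injective (fun p : Fin N × Fin N × Fin N => (p, b p)) :=
        fun p p' h => (Prod.mk.inj h).1
      rw [← Finset.sum_image (f := fun j => w j ^ (m + 2)) (fun p _ p' _ h => hinj h)]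
      exact Finset.sum_le_sum_of_subset_of_nonneg (Finset.subset_univ _) fun j _ _ => pow_nonneg (hw0 j) _
    -- assemble: `(c/2) N^{3/2} q^t ≤ ½ q^t bandSum ≤ ½ Σ_j w_j^t ≤ x_t`
    have hqt : 0 ≤ q ^ (m + 2) := pow_nonneg hq0 _
    calc c / 2 * Real.sqrt (N : ℝ) ^ 3 * q ^ (m + 2)
        = (1 / 2 : ℝ) * (q ^ (m + 2) * (c * Real.sqrt (N : ℝ) ^ 3)) := by ring
      _ ≤ (1 / 2 : ℝ) * (q ^ (m + 2) * bandSum κ N (m + 2)) :=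
          mul_le_mul_of_nonneg_left (mul_le_mul_of_nonneg_left hcount hqt) (by norm_num)
      _ ≤ (1 / 2 : ℝ) * ∑ j, w j ^ (m + 2) :=
          mul_le_mul_of_nonneg_left (hslice.trans hsub) (by norm_num)
      _ ≤ traceExcess r.ρ β N (m + 2) := hlow m hmN

/-- The banked floor implies the load-bearing dichotomy (branch 1 at every `β`). -/
theorem oneGlueballBandDichotomy_of_oneGlueballBandLower (h : OneGlueballBandLower) : OneGlueballBandDichotomy := by
  intro G _ _ _ _ r
  obtain ⟨a, ha, L₀, hL₀⟩ := h G r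
  exact ⟨a, ha, 1, one_pos, L₀, fun β hβ0 hβ => Or.inl (fun N _ m hm hN => hL₀ β hβ0 hβ N m hm hN)⟩

/-- **THE THERMAL DOOR: two-sided Bloch-form trace asymptotics ⇒ the crux `OneGlueballBandDichotomy` BY NAME.** -/
theorem oneGlueballBandDichotomy_of_traceAsymptotics
    (hT : ∀ (G : Type) [Group G] [TopologicalSpace G] [IsTopologicalGroup G] [CompactSpace G],
      letI : MeasurableSpace G := borel G
      haveI : BorelSpace G := ⟨rfl⟩
      ∀ r : LatticeRep G, ∃ κ : ℝ, 0 < κ ∧ ∃ L₀ : ℕ, ∀ β : ℝ, 0 ≤ β → β ≤ strongCouplingRadius r.ρ →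
        ∀ (N : ℕ) [NeZero N], L₀ ≤ N →
          ∃ (n : ℕ) (w : (Fin N × Fin N × Fin N) × Fin n → ℝ), (∀ j, 0 ≤ w j) ∧
            (∀ m : ℕ, traceExcess r.ρ β N (m + 2) ≤ 2 * ∑ j, w j ^ (m + 2)) ∧
            (∀ m : ℕ, m + 2 ≤ N → (1 / 2 : ℝ) * ∑ j, w j ^ (m + 2) ≤ traceExcess r.ρ β N (m + 2)) ∧
            ∃ p₀ : Fin N × Fin N × Fin N, ∀ p : Fin N × Fin N × Fin N, ∃ b : Fin n, ∀ j,
              w j * Real.exp (-(κ * (momSq N (p - p₀) : ℝ) / (N : ℝ) ^ 2)) ≤ w (p, b)) :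
    OneGlueballBandDichotomy :=
  oneGlueballBandDichotomy_of_oneGlueballBandLower (oneGlueballBandLower_of_traceAsymptotics hT)

/-! ### The thermal door with the upper bound required only EVENTUALLY in the Euclidean time

In large volume the thermal trace at SHORT times is dominated by multi-particle states (`x_2(N) ≈ exp(3nN³a(β)⁸·c) − 1` is
exponentially large in the volume), so the upper bound `x_{m+2} ≤ 2Σ_j w_j^{m+2}` by a one-particle Bloch family can only hold for `m`
large (depending on `β, N`).  Only the `m → ∞` tail is used to identify the rate (`q_N ≤ max_j w_j`), and the lower bound is used only at
the crux time `⌊N/4⌋`; the following versions ask for exactly that. -/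

/-- **The rate sits under the top weight (eventual form)**: if `x_{k+2}(N) ≤ D·W^{k+2}` for all `k ≥ k₀` (`D > 0`, `W ≥ 0`, `β ≥ 0`), then
`q_N ≤ W`. -/
theorem rate_le_of_eventually_traceExcess_le_mul_pow {G : Type} [Group G] [TopologicalSpace G] [IsTopologicalGroup G]
    [CompactSpace G] [MeasurableSpace G] [BorelSpace G] (r : LatticeRep G) {β : ℝ} (hβ : 0 ≤ β) (N : ℕ) [NeZero N]
    {D W : ℝ} (hD : 0 < D) (hW : 0 ≤ W) (k₀ : ℕ)
    (h : ∀ k : ℕ, k₀ ≤ k → traceExcess r.ρ β N (k + 2) ≤ D * W ^ (k + 2)) :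
    (⨅ k : ℕ, traceExcess r.ρ β N (k + 2) ^ ((1 : ℝ) / ((k : ℝ) + 2))) ≤ W := by
  haveI : SecondCountableTopology G :=
    (r.continuous.isClosedEmbedding r.injective).isEmbedding.secondCountableTopology
  have hlim := tendsto_root_traceExcess r hβ N
  have hlim' : Tendsto (fun k : ℕ => D ^ ((1 : ℝ) / ((k : ℝ) + 2)) * W) atTop (𝓝 W) := by
    have h := (tendsto_const_rpow_inv_add_two hD).mul_const W
    rwa [one_mul] at h
  refine le_of_tendsto_of_tendsto hlim hlim' ?_
  rw [Filter.EventuallyLE, Filter.eventually_atTop]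
  refine ⟨k₀, fun k hk => ?_⟩
  have hx0 : 0 ≤ traceExcess r.ρ β N (k + 2) := Rate.traceExcess_nonneg r.continuous r.mem_unitary hβ N k
  have hexp : 0 ≤ (1 : ℝ) / ((k : ℝ) + 2) := by positivity
  have hexp' : (1 : ℝ) / ((k : ℝ) + 2) = ((k + 2 : ℕ) : ℝ)⁻¹ := by push_cast; rw [one_div]
  calc traceExcess r.ρ β N (k + 2) ^ ((1 : ℝ) / ((k : ℝ) + 2))
      ≤ (D * W ^ (k + 2)) ^ ((1 : ℝ) / ((k : ℝ) + 2)) := Real.rpow_le_rpow hx0 (h k hk) hexp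
    _ = D ^ ((1 : ℝ) / ((k : ℝ) + 2)) * (W ^ (k + 2)) ^ ((1 : ℝ) / ((k : ℝ) + 2)) :=
        Real.mul_rpow hD.le (pow_nonneg hW _)
    _ = D ^ ((1 : ℝ) / ((k : ℝ) + 2)) * W := by
        rw [hexp', Real.pow_rpow_inv_natCast hW (by omega)]

/-- **THE THERMAL DOOR, sharp hypotheses (banked form)**: per `(β, N ≥ L₀)` a finite Bloch family `w ≥ 0` with
(i) EVENTUALLY in `m`: `x_{m+2}(N) ≤ 2·Σ_j w_j^{m+2}` (upper gap at large times — identifies the rate),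
(ii) at the crux time only: `½·Σ_j w_j^{m+2} ≤ x_{m+2}(N)` for `N/4 = m+2`,
(iii) a Gaussian-flat top slice (`∀ p ∃ b ∀ j: w_j·e^{−κ momSq(p−p₀)/N²} ≤ w_{(p,b)}`),
implies `OneGlueballBandLower` (`a = c(κ)/2`). -/
theorem oneGlueballBandLower_of_traceAsymptotics_eventually
    (hT : ∀ (G : Type) [Group G] [TopologicalSpace G] [IsTopologicalGroup G] [CompactSpace G],
      letI : MeasurableSpace G := borel G
      haveI : BorelSpace G := ⟨rfl⟩
      ∀ r : LatticeRep G, ∃ κ : ℝ, 0 < κ ∧ ∃ L₀ : ℕ, ∀ β : ℝ, 0 ≤ β → β ≤ strongCouplingRadius r.ρ →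
        ∀ (N : ℕ) [NeZero N], L₀ ≤ N →
          ∃ (n : ℕ) (w : (Fin N × Fin N × Fin N) × Fin n → ℝ), (∀ j, 0 ≤ w j) ∧
            (∃ m₀ : ℕ, ∀ m : ℕ, m₀ ≤ m → traceExcess r.ρ β N (m + 2) ≤ 2 * ∑ j, w j ^ (m + 2)) ∧
            (∀ m : ℕ, N / 4 = m + 2 → (1 / 2 : ℝ) * ∑ j, w j ^ (m + 2) ≤ traceExcess r.ρ β N (m + 2)) ∧
            ∃ p₀ : Fin N × Fin N × Fin N, ∀ p : Fin N × Fin N × Fin N, ∃ b : Fin n, ∀ j,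
              w j * Real.exp (-(κ * (momSq N (p - p₀) : ℝ) / (N : ℝ) ^ 2)) ≤ w (p, b)) :
    OneGlueballBandLower := by
  intro G _ _ _ _
  letI : MeasurableSpace G := borel G
  haveI : BorelSpace G := ⟨rfl⟩
  intro r
  obtain ⟨κ, hκ, L₀, hL₀⟩ := hT G r
  obtain ⟨c, hc, N₀, hN₀⟩ := stub_gaussianLatticeCount κ hκ
  refine ⟨c / 2, by positivity, max L₀ N₀, fun β hβ0 hβ N _ m hm hN => ?_⟩
  haveI : SecondCountableTopology G :=
    (r.continuous.isClosedEmbedding r.injective).isEmbedding.secondCountableTopology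
  have hL₀N : L₀ ≤ N := le_trans (le_max_left _ _) hN
  have hN₀N : N₀ ≤ N := le_trans (le_max_right _ _) hN
  obtain ⟨n, w, hw0, ⟨m₀, hup⟩, hlow, p₀, hshape⟩ := hL₀ β hβ0 hβ N hL₀N
  set q : ℝ := ⨅ k : ℕ, traceExcess r.ρ β N (k + 2) ^ ((1 : ℝ) / ((k : ℝ) + 2)) with hqdef
  have hq0 : 0 ≤ q := Rate.rate_nonneg r.continuous r.mem_unitary hβ0 N
  have hx0 : 0 ≤ traceExcess r.ρ β N (m + 2) := Rate.traceExcess_nonneg r.continuous r.mem_unitary hβ0 N m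
  have hcount := hN₀ N m hm hN₀N
  rcases isEmpty_or_nonempty ((Fin N × Fin N × Fin N) × Fin n) with hJ | hJ
  · haveI := hJ
    have hx00 : ∀ k, m₀ ≤ k → traceExcess r.ρ β N (k + 2) ≤ 1 * (0 : ℝ) ^ (k + 2) := fun k hk => by
      have h := hup k hk
      have hs : ∑ j : (Fin N × Fin N × Fin N) × Fin n, w j ^ (k + 2) = 0 :=
        Finset.sum_eq_zero fun j _ => (IsEmpty.false j).elim
      rw [hs, mul_zero] at h
      have h0 : (1 : ℝ) * (0 : ℝ) ^ (k + 2) = 0 := by rw [zero_pow (by omega), mul_zero]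
      rw [h0]
      exact h
    have hq00 : q ≤ 0 := rate_le_of_eventually_traceExcess_le_mul_pow r hβ0 N one_pos le_rfl m₀ hx00
    have hq : q = 0 := le_antisymm hq00 hq0
    calc c / 2 * Real.sqrt (N : ℝ) ^ 3 * q ^ (m + 2) = 0 := by rw [hq, zero_pow (by omega)]; ring
      _ ≤ traceExcess r.ρ β N (m + 2) := hx0
  · haveI := hJ
    obtain ⟨jstar, -, hjstar⟩ := Finset.exists_max_image Finset.univ w Finset.univ_nonempty
    set W : ℝ := w jstar with hWdef
    have hW0 : 0 ≤ W := hw0 jstar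
    have hM : 0 < (Fintype.card ((Fin N × Fin N × Fin N) × Fin n) : ℝ) := by exact_mod_cast Fintype.card_pos
    have hD : 0 < 2 * (Fintype.card ((Fin N × Fin N × Fin N) × Fin n) : ℝ) := by positivity
    have hqW : q ≤ W := by
      refine rate_le_of_eventually_traceExcess_le_mul_pow r hβ0 N hD hW0 m₀ fun k hk => ?_
      calc traceExcess r.ρ β N (k + 2) ≤ 2 * ∑ j, w j ^ (k + 2) := hup k hk
        _ ≤ 2 * ∑ _j : (Fin N × Fin N × Fin N) × Fin n, W ^ (k + 2) := by
            refine mul_le_mul_of_nonneg_left (Finset.sum_le_sum fun j _ => ?_) (by norm_num)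
            exact pow_le_pow_left₀ (hw0 j) (hjstar j (Finset.mem_univ j)) _
        _ = 2 * (Fintype.card ((Fin N × Fin N × Fin N) × Fin n) : ℝ) * W ^ (k + 2) := by
            rw [Finset.sum_const, Finset.card_univ, nsmul_eq_mul]
            ring
    choose b hb using hshape
    have hslice : q ^ (m + 2) * bandSum κ N (m + 2) ≤ ∑ p : Fin N × Fin N × Fin N, w (p, b p) ^ (m + 2) := by
      rw [bandSum, Finset.mul_sum]
      rw [← (Fintype.sum_equiv (Equiv.subRight p₀) (fun p => q ^ (m + 2) *
        Real.exp (-(κ * ↑(m + 2) * (momSq N (p - p₀) : ℝ) / (N : ℝ) ^ 2))) _ fun p => rfl)]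
      refine Finset.sum_le_sum fun p _ => ?_
      have h1 : q * Real.exp (-(κ * (momSq N (p - p₀) : ℝ) / (N : ℝ) ^ 2)) ≤ w (p, b p) :=
        le_trans (mul_le_mul_of_nonneg_right hqW (Real.exp_nonneg _)) (hb p jstar)
      have h0 : 0 ≤ q * Real.exp (-(κ * (momSq N (p - p₀) : ℝ) / (N : ℝ) ^ 2)) := mul_nonneg hq0 (Real.exp_nonneg _)
      have hexp : Real.exp (-(κ * (momSq N (p - p₀) : ℝ) / (N : ℝ) ^ 2)) ^ (m + 2) =
          Real.exp (-(κ * ↑(m + 2) * (momSq N (p - p₀) : ℝ) / (N : ℝ) ^ 2)) := by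
        rw [← Real.exp_nat_mul]
        congr 1
        ring
      have h2 := pow_le_pow_left₀ h0 h1 (m + 2)
      rwa [mul_pow, hexp] at h2
    have hsub : ∑ p : Fin N × Fin N × Fin N, w (p, b p) ^ (m + 2) ≤ ∑ j, w j ^ (m + 2) := by
      have hinj : Function.Injective (fun p : Fin N × Fin N × Fin N => (p, b p)) :=
        fun p p' h => (Prod.mk.inj h).1
      rw [← Finset.sum_image (f := fun j => w j ^ (m + 2)) (fun p _ p' _ h => hinj h)]
      exact Finset.sum_le_sum_of_subset_of_nonneg (Finset.subset_univ _) fun j _ _ => pow_nonneg (hw0 j) _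
    have hqt : 0 ≤ q ^ (m + 2) := pow_nonneg hq0 _
    calc c / 2 * Real.sqrt (N : ℝ) ^ 3 * q ^ (m + 2)
        = (1 / 2 : ℝ) * (q ^ (m + 2) * (c * Real.sqrt (N : ℝ) ^ 3)) := by ring
      _ ≤ (1 / 2 : ℝ) * (q ^ (m + 2) * bandSum κ N (m + 2)) :=
          mul_le_mul_of_nonneg_left (mul_le_mul_of_nonneg_left hcount hqt) (by norm_num)
      _ ≤ (1 / 2 : ℝ) * ∑ j, w j ^ (m + 2) :=
          mul_le_mul_of_nonneg_left (hslice.trans hsub) (by norm_num)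
      _ ≤ traceExcess r.ρ β N (m + 2) := hlow m hm

/-- **THE THERMAL DOOR, sharp hypotheses: ⇒ the crux `OneGlueballBandDichotomy` BY NAME.** -/
theorem oneGlueballBandDichotomy_of_traceAsymptotics_eventually
    (hT : ∀ (G : Type) [Group G] [TopologicalSpace G] [IsTopologicalGroup G] [CompactSpace G],
      letI : MeasurableSpace G := borel G
      haveI : BorelSpace G := ⟨rfl⟩
      ∀ r : LatticeRep G, ∃ κ : ℝ, 0 < κ ∧ ∃ L₀ : ℕ, ∀ β : ℝ, 0 ≤ β → β ≤ strongCouplingRadius r.ρ →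
        ∀ (N : ℕ) [NeZero N], L₀ ≤ N →
          ∃ (n : ℕ) (w : (Fin N × Fin N × Fin N) × Fin n → ℝ), (∀ j, 0 ≤ w j) ∧
            (∃ m₀ : ℕ, ∀ m : ℕ, m₀ ≤ m → traceExcess r.ρ β N (m + 2) ≤ 2 * ∑ j, w j ^ (m + 2)) ∧
            (∀ m : ℕ, N / 4 = m + 2 → (1 / 2 : ℝ) * ∑ j, w j ^ (m + 2) ≤ traceExcess r.ρ β N (m + 2)) ∧
            ∃ p₀ : Fin N × Fin N × Fin N, ∀ p : Fin N × Fin N × Fin N, ∃ b : Fin n, ∀ j,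
              w j * Real.exp (-(κ * (momSq N (p - p₀) : ℝ) / (N : ℝ) ^ 2)) ≤ w (p, b)) :
    OneGlueballBandDichotomy :=
  oneGlueballBandDichotomy_of_oneGlueballBandLower (oneGlueballBandLower_of_traceAsymptotics_eventually hT)

end Summit.QuantumFields.YangMills.Theorems.GlueballBandRecursion.Band

end
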